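import Summits.QuantumAdvantage.AdviceFreeQNC0.BlockDefects
import HarnessLib

/-!
# Cell qa-qnc0, `p = 3` — the QUANTITATIVE block lemma (planner qa-qnc0-p1 g20, ask P-20e′; ROUND-19 §3 addendum
02:02Z; `exp20/Sketch20x.lean` §8, statement `blockOpR_contracts_quant` VERBATIM)

**`rnsq_blockOpR_le_quant`: `rnsq (blockOpR ζ ω ε f) ≤ (1 − 1/(16(2r+1))) · rnsq f`** for a primitive cube root `ζ` at
the first site, arbitrary UNIMODULAR phases `ω j` later and arbitrary sign patterns — whence the planner's
**`blockOpR_contracts_quant`** (`1 − 1/(32(2r+1)²)`, verbatim) a fortiori.  The decay per disjoint block is therefore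
polynomial (indeed LINEAR) in the radius, which is what the polylog-radius rung `RingLinFormsLocalPolyLt3` needs.

Proof (the near-equality version of the 2-cycle of `BlockRigidity.lean`; bookkeeping in `BlockDefects.lean`):
* telescoped defect: `rnsq (B f) + ¼·Σ_j D_j ≤ rnsq f`, `D_j` the `ℓ²` alignment defect of stage `j` (`rnsq_chainOp_add_defect_le`);
* transport with error: `|(B f)(σ) − Φ_w θ f(σ·w)| ≤ ½ Σ_j |d_j(σ·w_{<j})|` (`chainOp_approx`);
* 2-cycle with error: `|f(σ·(1,w))| ≤ E(σ,1w) + E(σ,0w) + E(σ♭,1w) + E(σ♭,0w)` using `|ζ² ∓ 1| ≥ 1` (`norm_apply_run_le`);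
* averaging over all `2^{2r+1}` ways of writing a state as `σ·(b,w)` (`sum_bsum_run`) and Cauchy–Schwarz:
  `rnsq f ≤ 4(2r+1)·Σ_j D_j ≤ 16(2r+1)·(rnsq f − rnsq (B f))`.

WHAT THIS IS NOT: not the conjectured radius-free `BlockNormUniform3`; no strategy bound by itself (the path-sum assembly
`twistBoundX3Local_of` is still open); crux 22907 untouched; separation NOT moved.
-/

namespace Summit.QuantumAdvantage.AdviceFreeQNC0

open Finset Literature.Computability.QuantumComplexity

namespace BondTwist3

variable {r : ℕ}

/-! ## The 2-cycle with error -/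

/-- `ζ² + ζ + 1 = 0` for a primitive cube root. -/
theorem cube_root_sum {ζ : ℂ} (hζ3 : ζ ^ 3 = 1) (hζ1 : ζ ≠ 1) : ζ ^ 2 + ζ + 1 = 0 := by
  have h : (ζ - 1) * (ζ ^ 2 + ζ + 1) = 0 := by linear_combination hζ3
  exact (mul_eq_zero.1 h).resolve_left (sub_ne_zero.2 hζ1)

/-- `|ζ² − θ| ≥ 1` for `θ = ±1`. -/
theorem one_le_norm_sq_sub {ζ : ℂ} (hζ3 : ζ ^ 3 = 1) (hζ1 : ζ ≠ 1) (θ : ℂ) (hθ : θ = 1 ∨ θ = -1) :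
    1 ≤ ‖ζ ^ 2 - θ‖ := by
  have hs := cube_root_sum hζ3 hζ1
  have hn := norm_eq_one_of_cube hζ3
  rcases hθ with rfl | rfl
  · have h : ζ ^ 2 - 1 = -(2 + ζ) := by linear_combination hs
    rw [h, norm_neg]
    have := norm_sub_norm_le (2 : ℂ) (-ζ)
    rw [norm_neg, hn, Complex.norm_two, sub_neg_eq_add] at this
    linarith
  · have h : ζ ^ 2 - -1 = -ζ := by linear_combination hs
    rw [h, norm_neg, hn]

/-- Products of signs are signs. -/
theorem pm_mul {a b : ℂ} (ha : a = 1 ∨ a = -1) (hb : b = 1 ∨ b = -1) : a * b = 1 ∨ a * b = -1 := by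
  rcases ha with rfl | rfl <;> rcases hb with rfl | rfl <;> simp

/-- Signs are unimodular. -/
theorem norm_pm {a : ℂ} (ha : a = 1 ∨ a = -1) : ‖a‖ = 1 := by
  rcases ha with rfl | rfl <;> simp

/-- The four path errors around the 2-cycle through `(σ, w)`. -/
noncomputable def cycErr (L : List (ℂ × (RegState r → Bool → Bool))) (f : RegState r → ℂ) (σ : RegState r)
    (W : List Bool) : ℝ :=
  pathErr L f σ (true :: W) + pathErr L f σ (false :: W) +
    (pathErr L f (flipSpin σ) (true :: W) + pathErr L f (flipSpin σ) (false :: W))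

/-- **The 2-cycle with error**: `|f(σ·(1,w))| ≤` the four path errors. -/
theorem norm_apply_run_le {ζ : ℂ} (hζ3 : ζ ^ 3 = 1) (hζ1 : ζ ≠ 1) (e : RegState r → Bool → Bool)
    (l : List (ℂ × (RegState r → Bool → Bool))) (hl : l.length = 2 * r) (hl1 : ∀ p ∈ l, ‖p.1‖ = 1)
    (f : RegState r → ℂ) (σ : RegState r) (W : List Bool) (hW : W.length = 2 * r) :
    ‖f (run σ (true :: W))‖ ≤ cycErr ((ζ, e) :: l) f σ W := by
  obtain ⟨S, s, reg⟩ := σ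
  have hζn := norm_eq_one_of_cube hζ3
  have hnorm : ∀ p ∈ (ζ, e) :: l, ‖p.1‖ ≤ 1 := by
    intro p hp
    simp only [List.mem_cons] at hp
    rcases hp with rfl | hp
    · exact hζn.le
    · exact (hl1 p hp).le
  have h0 := run_false_cons S s reg W (by omega)
  have h1 := run_false_cons S (!s) reg W (by omega)
  rw [Bool.not_not] at h1
  have hlen : ∀ b : Bool, (b :: W).length = ((ζ, e) :: l).length := fun b => by simp [hW, hl]
  obtain ⟨θ₁, hθ₁, e1⟩ := chainOp_approx _ hnorm f (S, s, reg) (true :: W) (hlen true)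
  obtain ⟨θ₂, hθ₂, e2⟩ := chainOp_approx _ hnorm f (S, s, reg) (false :: W) (hlen false)
  obtain ⟨θ₃, hθ₃, e3⟩ := chainOp_approx _ hnorm f (S, !s, reg) (true :: W) (hlen true)
  obtain ⟨θ₄, hθ₄, e4⟩ := chainOp_approx _ hnorm f (S, !s, reg) (false :: W) (hlen false)
  rw [← h0] at e3
  rw [h1] at e4
  simp only [phaseProd, if_true, Bool.false_eq_true, if_false, one_mul] at e1 e2 e3 e4
  set Φ := phaseProd l W with hΦ
  set A := chainOp ((ζ, e) :: l) f (S, s, reg)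
  set A' := chainOp ((ζ, e) :: l) f (S, !s, reg)
  set u := f (run ((S, s, reg) : RegState r) (true :: W))
  set v := f (run ((S, s, reg) : RegState r) (false :: W))
  have hΦn : ‖Φ‖ = 1 := norm_phaseProd l hl1 W
  have hθ₂sq : θ₂ * θ₂ = 1 := by rcases hθ₂ with rfl | rfl <;> norm_num
  have key : (ζ ^ 2 * (θ₁ * θ₂ * θ₃) - θ₄) * Φ * u =
      ζ * θ₂ * θ₃ * (ζ * Φ * θ₁ * u - A) + ζ * θ₂ * θ₃ * (A - Φ * θ₂ * v) + (ζ * Φ * θ₃ * v - A') +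
        (A' - Φ * θ₄ * u) := by
    linear_combination (ζ * Φ * θ₃ * v) * hθ₂sq
  have hΘ := pm_mul (pm_mul hθ₁ hθ₂) hθ₃
  have hge : 1 ≤ ‖ζ ^ 2 * (θ₁ * θ₂ * θ₃) - θ₄‖ := by
    have hid : ζ ^ 2 * (θ₁ * θ₂ * θ₃) - θ₄ = (θ₁ * θ₂ * θ₃) * (ζ ^ 2 - (θ₁ * θ₂ * θ₃) * θ₄) := by
      have hsq : (θ₁ * θ₂ * θ₃) * (θ₁ * θ₂ * θ₃) = 1 := by rcases hΘ with h | h <;> rw [h] <;> norm_num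
      linear_combination (θ₄ : ℂ) * hsq
    rw [hid, norm_mul, norm_pm hΘ, one_mul]
    exact one_le_norm_sq_sub hζ3 hζ1 _ (pm_mul hΘ hθ₄)
  have hlhs : ‖u‖ ≤ ‖(ζ ^ 2 * (θ₁ * θ₂ * θ₃) - θ₄) * Φ * u‖ := by
    rw [norm_mul, norm_mul, hΦn, mul_one]
    exact le_mul_of_one_le_left (norm_nonneg _) hge
  have hrhs : ‖(ζ ^ 2 * (θ₁ * θ₂ * θ₃) - θ₄) * Φ * u‖ ≤
      pathErr ((ζ, e) :: l) f (S, s, reg) (true :: W) + pathErr ((ζ, e) :: l) f (S, s, reg) (false :: W) +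
        (pathErr ((ζ, e) :: l) f (S, !s, reg) (true :: W) + pathErr ((ζ, e) :: l) f (S, !s, reg) (false :: W)) := by
    rw [key]
    have n1 : ‖ζ * θ₂ * θ₃ * (ζ * Φ * θ₁ * u - A)‖ ≤ pathErr ((ζ, e) :: l) f (S, s, reg) (true :: W) := by
      rw [norm_mul, norm_mul, norm_mul, hζn, norm_pm hθ₂, norm_pm hθ₃, one_mul, one_mul, one_mul, norm_sub_rev]
      exact e1
    have n2 : ‖ζ * θ₂ * θ₃ * (A - Φ * θ₂ * v)‖ ≤ pathErr ((ζ, e) :: l) f (S, s, reg) (false :: W) := by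
      rw [norm_mul, norm_mul, norm_mul, hζn, norm_pm hθ₂, norm_pm hθ₃, one_mul, one_mul, one_mul]
      exact e2
    have n3 : ‖ζ * Φ * θ₃ * v - A'‖ ≤ pathErr ((ζ, e) :: l) f (S, !s, reg) (true :: W) := by
      rw [norm_sub_rev]; exact e3
    have n4 : ‖A' - Φ * θ₄ * u‖ ≤ pathErr ((ζ, e) :: l) f (S, !s, reg) (false :: W) := e4
    refine (norm_add_le _ _).trans (add_le_add ((norm_add_le _ _).trans
      (add_le_add ((norm_add_le _ _).trans (add_le_add n1 n2)) n3)) n4) |>.trans ?_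
    linarith
  simp only [cycErr, flipSpin]
  exact hlhs.trans hrhs

/-- Both states `σ·(b,w)` are controlled by the same four path errors. -/
theorem norm_apply_run_le' {ζ : ℂ} (hζ3 : ζ ^ 3 = 1) (hζ1 : ζ ≠ 1) (e : RegState r → Bool → Bool)
    (l : List (ℂ × (RegState r → Bool → Bool))) (hl : l.length = 2 * r) (hl1 : ∀ p ∈ l, ‖p.1‖ = 1)
    (f : RegState r → ℂ) (σ : RegState r) (b : Bool) (W : List Bool) (hW : W.length = 2 * r) :
    ‖f (run σ (b :: W))‖ ≤ cycErr ((ζ, e) :: l) f σ W := by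
  cases b with
  | true => exact norm_apply_run_le hζ3 hζ1 e l hl hl1 f σ W hW
  | false =>
    obtain ⟨S, s, reg⟩ := σ
    rw [run_false_cons S s reg W (by omega)]
    refine (norm_apply_run_le hζ3 hζ1 e l hl hl1 f (S, !s, reg) W hW).trans (le_of_eq ?_)
    simp only [cycErr, flipSpin, Bool.not_not]
    ring

/-! ## Assembly -/

/-- `(a+b+c+d)² ≤ 4(a²+b²+c²+d²)`. -/
theorem sq_add_four_le (a b c d : ℝ) : (a + b + (c + d)) ^ 2 ≤ 4 * (a ^ 2 + b ^ 2 + (c ^ 2 + d ^ 2)) := by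
  nlinarith [sq_nonneg (a - b), sq_nonneg (a - c), sq_nonneg (a - d), sq_nonneg (b - c), sq_nonneg (b - d),
    sq_nonneg (c - d)]

/-- **`rnsq f ≤ 4(2r+1)·chainDefect`** for the block chain. -/
theorem rnsq_le_chainDefect {ζ : ℂ} (hζ3 : ζ ^ 3 = 1) (hζ1 : ζ ≠ 1) (e : RegState r → Bool → Bool)
    (l : List (ℂ × (RegState r → Bool → Bool))) (hl : l.length = 2 * r) (hl1 : ∀ p ∈ l, ‖p.1‖ = 1)
    (f : RegState r → ℂ) : rnsq f ≤ 4 * (2 * r + 1) * chainDefect ((ζ, e) :: l) f := by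
  set L := (ζ, e) :: l with hL
  have hLl : L.length = 2 * r + 1 := by simp [hL, hl]
  set m : ℝ := (2 * r + 1 : ℝ) with hm
  -- the squared-defect functional along the four paths
  set Q : RegState r → List Bool → ℝ := fun σ W =>
    pathErrSq L f σ (true :: W) + pathErrSq L f σ (false :: W) +
      (pathErrSq L f (flipSpin σ) (true :: W) + pathErrSq L f (flipSpin σ) (false :: W)) with hQ
  -- pointwise: `‖f(σ·bs)‖² ≤ m · Q σ bs.tail` for `|bs| = 2r+1`
  have hpt : ∀ (σ : RegState r) (bs : List Bool), bs.length = 2 * r + 1 →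
      ‖f (run σ bs)‖ ^ 2 ≤ m * Q σ bs.tail := by
    intro σ bs hbs
    cases bs with
    | nil => simp at hbs
    | cons b W =>
      have hW : W.length = 2 * r := by simpa using hbs
      have h1 := norm_apply_run_le' hζ3 hζ1 e l hl hl1 f σ b W hW
      have h2 : ‖f (run σ (b :: W))‖ ^ 2 ≤ cycErr L f σ W ^ 2 := pow_le_pow_left₀ (norm_nonneg _) h1 2
      have hcs : ∀ (τ : RegState r) (bs : List Bool), pathErr L f τ bs ^ 2 ≤ m / 4 * pathErrSq L f τ bs := by
        intro τ bs
        have := pathErr_sq_le L f τ bs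
        rw [hLl] at this
        simpa [hm] using this
      have h3 := sq_add_four_le (pathErr L f σ (true :: W)) (pathErr L f σ (false :: W))
        (pathErr L f (flipSpin σ) (true :: W)) (pathErr L f (flipSpin σ) (false :: W))
      have := hcs σ (true :: W)
      have := hcs σ (false :: W)
      have := hcs (flipSpin σ) (true :: W)
      have := hcs (flipSpin σ) (false :: W)
      simp only [List.tail_cons, hQ]
      simp only [cycErr] at h2
      nlinarith
  -- average over all ways of writing a state as `σ·bs`
  have hsum : (2 : ℝ) ^ (2 * r + 1) * rnsq f ≤ m * (2 * (2 * ((2 : ℝ) ^ (2 * r + 1) * chainDefect L f))) := by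
    have hre := sum_bsum_run (2 * r + 1) (fun τ : RegState r => ‖f τ‖ ^ 2)
    unfold rnsq
    rw [← hre]
    have hQsum : ∀ σ : RegState r, bsum (2 * r) (Q σ) =
        bsum (2 * r + 1) (pathErrSq L f σ) + bsum (2 * r + 1) (pathErrSq L f (flipSpin σ)) := by
      intro σ
      simp only [hQ, bsum]
      rw [bsum_add, bsum_add, bsum_add]
      ring
    have htail : ∀ σ : RegState r, bsum (2 * r + 1) (fun bs => m * Q σ bs.tail) = m * (2 * bsum (2 * r) (Q σ)) := by
      intro σ
      simp only [bsum, List.tail_cons]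
      rw [bsum_const_mul]
      ring
    have hPS := sum_bsum_pathErrSq L f
    rw [hLl] at hPS
    calc ∑ σ : RegState r, bsum (2 * r + 1) (fun bs => ‖f (run σ bs)‖ ^ 2)
        ≤ ∑ σ : RegState r, bsum (2 * r + 1) (fun bs => m * Q σ bs.tail) :=
          sum_le_sum fun σ _ => bsum_mono _ _ _ fun bs hbs => hpt σ bs hbs
      _ = ∑ σ : RegState r, m * (2 * (bsum (2 * r + 1) (pathErrSq L f σ) +
            bsum (2 * r + 1) (pathErrSq L f (flipSpin σ)))) :=
          sum_congr rfl fun σ _ => by rw [htail σ, hQsum σ]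
      _ = m * (2 * ∑ σ : RegState r, (bsum (2 * r + 1) (pathErrSq L f σ) +
            bsum (2 * r + 1) (pathErrSq L f (flipSpin σ)))) := by
          rw [← mul_sum, ← mul_sum]
      _ = m * (2 * (2 * ∑ σ : RegState r, bsum (2 * r + 1) (pathErrSq L f σ))) := by
          rw [sum_add_distrib, sum_flipSpin (fun σ => bsum (2 * r + 1) (pathErrSq L f σ))]; ring
      _ = m * (2 * (2 * ((2 : ℝ) ^ (2 * r + 1) * chainDefect L f))) := by rw [hPS]
  have h2pos : (0 : ℝ) < (2 : ℝ) ^ (2 * r + 1) := by positivity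
  nlinarith

/-- **The quantitative block lemma (linear in the radius)**: `rnsq (B f) ≤ (1 − 1/(16(2r+1)))·rnsq f`. -/
theorem rnsq_blockOpR_le_quant (r : ℕ) (ζ : ℂ) (hζ3 : ζ ^ 3 = 1) (hζ1 : ζ ≠ 1)
    (ω : Fin (2 * r) → ℂ) (hω : ∀ j, ‖ω j‖ = 1)
    (ε : Fin (2 * r + 1) → RegState r → Bool → Bool) (f : RegState r → ℂ) :
    rnsq (blockOpR ζ ω ε f) ≤ (1 - 1 / (16 * (2 * (r : ℝ) + 1))) * rnsq f := by
  rw [blockOpR_eq_chainOp]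
  set l := List.ofFn fun j : Fin (2 * r) => (ω j, ε j.succ) with hl
  have hll : l.length = 2 * r := by simp [hl]
  have hl1 : ∀ p ∈ l, ‖p.1‖ = 1 := by
    intro p hp
    rw [hl, List.mem_ofFn', Set.mem_range] at hp
    obtain ⟨j, rfl⟩ := hp
    exact hω j
  have hnorm : ∀ p ∈ (ζ, ε 0) :: l, ‖p.1‖ ≤ 1 := by
    intro p hp
    simp only [List.mem_cons] at hp
    rcases hp with rfl | hp
    · exact (norm_eq_one_of_cube hζ3).le
    · exact (hl1 p hp).le
  have hA := rnsq_le_chainDefect hζ3 hζ1 (ε 0) l hll hl1 f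
  have hB := rnsq_chainOp_add_defect_le ((ζ, ε 0) :: l) hnorm f
  have hm : (0 : ℝ) < 16 * (2 * (r : ℝ) + 1) := by positivity
  rw [sub_mul, one_mul, div_mul_eq_mul_div, one_mul]
  have hC : chainDefect ((ζ, ε 0) :: l) f ≤ 4 * (rnsq f - rnsq (chainOp ((ζ, ε 0) :: l) f)) := by linarith
  have hD := mul_le_mul_of_nonneg_left hC (by positivity : (0 : ℝ) ≤ 4 * (2 * (r : ℝ) + 1))
  have hE : rnsq f / (16 * (2 * (r : ℝ) + 1)) ≤ rnsq f - rnsq (chainOp ((ζ, ε 0) :: l) f) := by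
    rw [div_le_iff₀ hm]
    linarith
  linarith

/-- **P-20e′ stub `blockOpR_contracts_quant` (Sketch20x §8, VERBATIM) — PROVED** (a fortiori from the linear bound). -/
theorem blockOpR_contracts_quant (r : ℕ) (ζ : ℂ) (hζ3 : ζ ^ 3 = 1) (hζ1 : ζ ≠ 1)
    (ω : Fin (2 * r) → ℂ) (hω : ∀ j, ‖ω j‖ = 1)
    (ε : Fin (2 * r + 1) → RegState r → Bool → Bool) (f : RegState r → ℂ) :
    rnsq (blockOpR ζ ω ε f) ≤ (1 - 1 / (32 * (2 * (r : ℝ) + 1) ^ 2)) * rnsq f := by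
  refine (rnsq_blockOpR_le_quant r ζ hζ3 hζ1 ω hω ε f).trans (mul_le_mul_of_nonneg_right ?_ (rnsq_nonneg f))
  have h0 : (0 : ℝ) < 2 * (r : ℝ) + 1 := by positivity
  have h1 : 16 * (2 * (r : ℝ) + 1) ≤ 32 * (2 * (r : ℝ) + 1) ^ 2 := by nlinarith
  have := one_div_le_one_div_of_le (by positivity) h1
  linarith

end BondTwist3

end Summit.QuantumAdvantage.AdviceFreeQNC0
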